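import Mathlib.Analysis.InnerProductSpace.Calculus
import Mathlib.Analysis.Calculus.FDeriv.Analytic
import Mathlib.Analysis.Calculus.Deriv.Shift
import Mathlib.Analysis.Analytic.OfScalars
import Mathlib.Topology.Algebra.InfiniteSum.NatInt
import Literature.Analysis.FluidPDE.CompressibleEulerImplosion
import HarnessLib

/-!
# Buckmaster–Cao-Labora–Gómez-Serrano, Theorem 1.1 at `γ = 5/3` — the glue layer

Topic `Literature/Analysis/FluidPDE`; namespace `Literature.Analysis.FluidPDE`. Companion of
`CompressibleEulerImplosion.lean`, towards the discharge of its named fact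
`BuckmasterCaolaboraGomezserrano2025_thm11_monatomic` (T. Buckmaster, G. Cao-Labora,
J. Gómez-Serrano, *Smooth imploding solutions for 3D compressible fluids*, Forum Math. Pi 13
(2025) e6, arXiv:2208.09445, THEOREM 1.1 at `γ = 5/3`). THEOREMS ONLY (no new facts).

The vendored fact is written for the radial velocity / rescaled-sound-speed profiles `U`, `S` seen
as fields on `ℝ³`. The paper constructs ONE function: the profile `𝒲 : ℝ → ℝ` of the Riemann
invariant `w = u + σ` in the self-similar variable `ζ = R/(T−t)^{1/r}`, extended to all of `ℝ` by
`𝒵(ζ) = −𝒲(−ζ)` (§1.3: "Since we will be looking for solutions that are smooth at the origin, we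
can extend the solution to all of `ζ ∈ ℝ` by requiring that `𝒵(ζ) = −𝒲(−ζ)`. The equations reduce
to a single equation in `𝒲`", eq. (1.10)):

  `(r−1)𝒲(ζ) + (ζ + ½(𝒲(ζ) − 𝒲(−ζ) + α(𝒲(ζ) + 𝒲(−ζ)))) ∂_ζ𝒲(ζ) + (α/(2ζ))(𝒲²(ζ) − 𝒲²(−ζ)) = 0`,

`α = (γ−1)/2 = 1/3`. In these terms `U = (𝒲 + 𝒵)/2` is the ODD part of `𝒲` and
`S = (𝒲 − 𝒵)/2` its EVEN part. This file proves (item H of the seat's plan, the only part of the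
printed proof that is pure Mathlib analysis):

* `BuckmasterCaolaboraGomezserrano2025.thm11_monatomic_of_profile`: the vendored fact follows
  from the existence of `r` in the window and a profile `𝒲` which is analytic at `ζ = 0`
  (Prop. 2.5 of the source: convergent power series `𝒲 = ∑ wᵢ ζⁱ`, `w₀ = A > 0`), smooth at
  every `ζ ≠ 0` (smooth through the sonic point `P_s` at `ζ = 1` — the content of Thm 1.1 — and
  an ODE solution elsewhere), solves (1.10) for `ζ ≠ 0`, has `𝒲(ζ) + 𝒲(−ζ) > 0` for `ζ ≥ 0`
  (the orbit lies in the half-plane `W > Z` "for which the density is positive", §1.3, and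
  `S(0) = A > 0`), and ends at `P_∞ = (0,0)`: `W = 𝒲(ζ)/ζ → 0`, `Z = −𝒲(−ζ)/ζ → 0` as `ζ → ∞`
  (Prop. 3.1);
* the two ingredients, usable independently: smoothness on an inner-product space of
  `y ↦ F ‖y‖` and of the radial field `y ↦ (F ‖y‖/‖y‖) • y` when `F` is, near `0`, `g(t²)`
  resp. `t·h(t²)` (`contDiff_comp_norm_of_sq_repr`, `contDiff_radialField_of_sq_repr`), the
  even/odd splitting `F t = g(t²) + t·h(t²)` of a real-analytic germ
  (`exists_sq_repr_of_analyticAt`), and the half-sum / half-difference algebra turning (1.10) at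
  `ζ` and `−ζ` into the `(U, S)` system of the fact (`US_system_of_profile_eq`).

[cite: BuckmasterCaolaboraGomezserrano2025, Thm 1.1, §1.3 eq. (1.9)–(1.10), Prop. 2.5, Prop. 3.1]
-/

noncomputable section

open Set Filter Topology
open scoped ContDiff NNReal ENNReal

namespace Literature.Analysis.FluidPDE

namespace BuckmasterCaolaboraGomezserrano2025

/-! ### Radial functions on an inner-product space built from an even / odd profile -/

section Radial

variable {E : Type*} [NormedAddCommGroup E] [InnerProductSpace ℝ E]

/-- If `F : ℝ → ℝ` is smooth away from `0` and agrees near `0` with `t ↦ g (t²)` for some `g`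
smooth at `0` (an even germ), then `y ↦ F ‖y‖` is smooth on the inner-product space `E`.
[folklore] -/
theorem contDiff_comp_norm_of_sq_repr {F g : ℝ → ℝ} (hF : ∀ t ≠ 0, ContDiffAt ℝ ∞ F t)
    (hg : ContDiffAt ℝ ∞ g 0) (hFg : ∀ᶠ t in 𝓝 0, F t = g (t ^ 2)) :
    ContDiff ℝ ∞ fun y : E => F ‖y‖ := by
  rw [contDiff_iff_contDiffAt]
  intro y
  by_cases hy : y = 0
  · subst hy
    have ht : Tendsto (fun y : E => ‖y‖) (𝓝 0) (𝓝 0) := continuous_norm.tendsto' 0 0 norm_zero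
    have hev : (fun y : E => F ‖y‖) =ᶠ[𝓝 0] fun y => g (‖y‖ ^ 2) := ht.eventually hFg
    refine ContDiffAt.congr_of_eventuallyEq ?_ hev
    have hg' : ContDiffAt ℝ ∞ g (‖(0 : E)‖ ^ 2) := by simpa using hg
    exact hg'.comp 0 (contDiff_norm_sq ℝ).contDiffAt
  · exact (hF ‖y‖ (norm_ne_zero_iff.mpr hy)).comp y (contDiffAt_norm ℝ hy)

/-- If `F : ℝ → ℝ` is smooth away from `0` and agrees near `0` with `t ↦ t * h (t²)` for some `h`
smooth at `0` (an odd germ), then the radial vector field `y ↦ (F ‖y‖ / ‖y‖) • y` is smooth on the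
inner-product space `E` (at `y = 0` its value is `0`). [folklore] -/
theorem contDiff_radialField_of_sq_repr {F h : ℝ → ℝ} (hF : ∀ t ≠ 0, ContDiffAt ℝ ∞ F t)
    (hh : ContDiffAt ℝ ∞ h 0) (hFh : ∀ᶠ t in 𝓝 0, F t = t * h (t ^ 2)) :
    ContDiff ℝ ∞ fun y : E => (F ‖y‖ / ‖y‖) • y := by
  rw [contDiff_iff_contDiffAt]
  intro y
  by_cases hy : y = 0
  · subst hy
    have ht : Tendsto (fun y : E => ‖y‖) (𝓝 0) (𝓝 0) := continuous_norm.tendsto' 0 0 norm_zero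
    have hev : (fun y : E => (F ‖y‖ / ‖y‖) • y) =ᶠ[𝓝 0] fun y => h (‖y‖ ^ 2) • y := by
      filter_upwards [ht.eventually hFh] with y hyF
      by_cases hy0 : y = 0
      · simp [hy0]
      · rw [hyF, mul_div_cancel_left₀ _ (norm_ne_zero_iff.mpr hy0)]
    refine ContDiffAt.congr_of_eventuallyEq ?_ hev
    have hh' : ContDiffAt ℝ ∞ h (‖(0 : E)‖ ^ 2) := by simpa using hh
    exact (hh'.comp 0 (contDiff_norm_sq ℝ).contDiffAt).smul contDiffAt_id
  · have hn : ContDiffAt ℝ ∞ (fun y : E => ‖y‖) y := contDiffAt_norm ℝ hy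
    have hq : ContDiffAt ℝ ∞ (fun y : E => F ‖y‖ / ‖y‖) y :=
      ((hF ‖y‖ (norm_ne_zero_iff.mpr hy)).comp y hn).div hn (norm_ne_zero_iff.mpr hy)
    exact hq.smul contDiffAt_id

end Radial

/-! ### Even / odd splitting of a real-analytic germ -/

open FormalMultilinearSeries in
/-- A function `F : ℝ → ℝ` analytic at `0` splits near `0` as `F t = g (t²) + t * h (t²)` with `g`,
`h` smooth at `0`: the even and odd parts of its power series (used with Prop. 2.5 of the source,
where `𝒲 = ∑ wᵢ ζⁱ` near `ζ = 0`, so that `S = ∑ w₂ⱼ ζ²ʲ` and `U = ∑ w₂ⱼ₊₁ ζ²ʲ⁺¹`).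
[folklore] -/
theorem exists_sq_repr_of_analyticAt {F : ℝ → ℝ} (hF : AnalyticAt ℝ F 0) :
    ∃ g h : ℝ → ℝ, ContDiffAt ℝ ∞ g 0 ∧ ContDiffAt ℝ ∞ h 0 ∧
      ∀ᶠ t in 𝓝 0, F t = g (t ^ 2) + t * h (t ^ 2) := by
  obtain ⟨p, ρ, hp⟩ := hF
  -- a positive real radius strictly inside the ball of convergence
  obtain ⟨r, hr0, hrρ⟩ : ∃ r : ℝ≥0, 0 < r ∧ (r : ℝ≥0∞) < ρ := by
    obtain ⟨r, h0r, hrρ⟩ := ENNReal.lt_iff_exists_nnreal_btwn.mp hp.r_pos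
    exact ⟨r, ENNReal.coe_pos.mp h0r, hrρ⟩
  obtain ⟨C, -, hC⟩ := p.norm_mul_pow_le_of_lt_radius (hrρ.trans_le hp.r_le)
  -- even and odd coefficient series
  set ce : ℕ → ℝ := fun j => p.coeff (2 * j) with hce
  set co : ℕ → ℝ := fun j => p.coeff (2 * j + 1) with hco
  have hrad_e : ((r ^ 2 : ℝ≥0) : ℝ≥0∞) ≤ (ofScalars ℝ ce).radius := by
    refine le_radius_of_bound _ C fun j => ?_
    have h1 : ‖ofScalars ℝ ce j‖ = ‖p (2 * j)‖ := by
      rw [ofScalars_norm, norm_apply_eq_norm_coef, hce]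
    calc ‖ofScalars ℝ ce j‖ * ((r ^ 2 : ℝ≥0) : ℝ) ^ j = ‖p (2 * j)‖ * (r : ℝ) ^ (2 * j) := by
          rw [h1, NNReal.coe_pow, ← pow_mul]
      _ ≤ C := hC (2 * j)
  have hrad_o : ((r ^ 2 : ℝ≥0) : ℝ≥0∞) ≤ (ofScalars ℝ co).radius := by
    refine le_radius_of_bound _ (C / r) fun j => ?_
    have h1 : ‖ofScalars ℝ co j‖ = ‖p (2 * j + 1)‖ := by
      rw [ofScalars_norm, norm_apply_eq_norm_coef, hco]
    rw [le_div_iff₀ (by exact_mod_cast hr0)]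
    calc ‖ofScalars ℝ co j‖ * ((r ^ 2 : ℝ≥0) : ℝ) ^ j * r
          = ‖p (2 * j + 1)‖ * (r : ℝ) ^ (2 * j + 1) := by
          rw [h1, NNReal.coe_pow, ← pow_mul, pow_succ]; ring
      _ ≤ C := hC (2 * j + 1)
  have h2pos : (0 : ℝ≥0∞) < ((r ^ 2 : ℝ≥0) : ℝ≥0∞) := ENNReal.coe_pos.mpr (pow_pos hr0 2)
  have hpos_e : 0 < (ofScalars ℝ ce).radius := h2pos.trans_le hrad_e
  have hpos_o : 0 < (ofScalars ℝ co).radius := h2pos.trans_le hrad_o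
  have hge : HasFPowerSeriesOnBall (ofScalars ℝ ce).sum (ofScalars ℝ ce) 0 ((r ^ 2 : ℝ≥0) : ℝ≥0∞) :=
    ((ofScalars ℝ ce).hasFPowerSeriesOnBall hpos_e).mono h2pos hrad_e
  have hgo : HasFPowerSeriesOnBall (ofScalars ℝ co).sum (ofScalars ℝ co) 0 ((r ^ 2 : ℝ≥0) : ℝ≥0∞) :=
    ((ofScalars ℝ co).hasFPowerSeriesOnBall hpos_o).mono h2pos hrad_o
  have hp' : HasFPowerSeriesOnBall F p 0 r := hp.mono (ENNReal.coe_pos.mpr hr0) hrρ.le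
  refine ⟨(ofScalars ℝ ce).sum, (ofScalars ℝ co).sum, hge.analyticAt.contDiffAt,
    hgo.analyticAt.contDiffAt, ?_⟩
  have hball : ∀ᶠ t in 𝓝 (0 : ℝ), t ∈ Metric.ball (0 : ℝ) r :=
    Metric.ball_mem_nhds 0 (by exact_mod_cast hr0)
  filter_upwards [hball] with t ht
  have ht' : |t| < r := by simpa [Real.dist_eq] using Metric.mem_ball.1 ht
  have ht2 : t ^ 2 ∈ Metric.eball (0 : ℝ) ((r ^ 2 : ℝ≥0) : ℝ≥0∞) := by
    rw [Metric.eball_coe, Metric.mem_ball, Real.dist_eq, sub_zero, NNReal.coe_pow, abs_pow]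
    exact pow_lt_pow_left₀ ht' (abs_nonneg t) two_ne_zero
  -- the full series at `t`
  have hFt : HasSum (fun n => t ^ n * p.coeff n) (F t) := by
    have := hp'.hasSum (y := t) (by rwa [Metric.eball_coe])
    simpa only [apply_eq_pow_smul_coeff, smul_eq_mul, zero_add] using this
  -- its even and odd parts
  have he0 := hge.hasSum ht2
  have ho0 := hgo.hasSum ht2
  simp only [ofScalars_apply_eq, smul_eq_mul, zero_add] at he0 ho0
  have he : HasSum (fun k => t ^ (2 * k) * p.coeff (2 * k)) ((ofScalars ℝ ce).sum (t ^ 2)) := by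
    have heq : (fun k : ℕ => t ^ (2 * k) * p.coeff (2 * k)) = fun n => ce n * (t ^ 2) ^ n := by
      funext k
      simp only [hce]
      rw [← pow_mul]
      ring
    rw [heq]
    exact he0
  have ho : HasSum (fun k => t ^ (2 * k + 1) * p.coeff (2 * k + 1))
      (t * (ofScalars ℝ co).sum (t ^ 2)) := by
    have heq : (fun k : ℕ => t ^ (2 * k + 1) * p.coeff (2 * k + 1)) =
        fun n => t * (co n * (t ^ 2) ^ n) := by
      funext k
      simp only [hco]
      rw [← pow_mul]
      ring
    rw [heq]
    exact ho0.mul_left t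
  exact hFt.unique (HasSum.even_add_odd (f := fun n => t ^ n * p.coeff n) he ho)

/-! ### Derivatives of the even and odd parts -/

/-- `d/dt F(−t) = −F′(−t)`. [folklore] -/
theorem hasDerivAt_comp_neg_of_differentiableAt {F : ℝ → ℝ} {t : ℝ}
    (h : DifferentiableAt ℝ F (-t)) : HasDerivAt (fun s => F (-s)) (-deriv F (-t)) t := by
  have hd : DifferentiableAt ℝ (fun s => F (-s)) t := differentiableAt_comp_neg.mpr h
  have h1 := hd.hasDerivAt
  rwa [deriv_comp_neg] at h1

/-- Derivative of the odd part `t ↦ (F t − F(−t))/2`. [folklore] -/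
theorem hasDerivAt_oddPart {F : ℝ → ℝ} {t : ℝ} (h₁ : DifferentiableAt ℝ F t)
    (h₂ : DifferentiableAt ℝ F (-t)) :
    HasDerivAt (fun s => (F s - F (-s)) / 2) ((deriv F t + deriv F (-t)) / 2) t := by
  exact ((h₁.hasDerivAt.sub (hasDerivAt_comp_neg_of_differentiableAt h₂)).div_const 2).congr_deriv
    (by ring)

/-- Derivative of the even part `t ↦ (F t + F(−t))/2`. [folklore] -/
theorem hasDerivAt_evenPart {F : ℝ → ℝ} {t : ℝ} (h₁ : DifferentiableAt ℝ F t)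
    (h₂ : DifferentiableAt ℝ F (-t)) :
    HasDerivAt (fun s => (F s + F (-s)) / 2) ((deriv F t - deriv F (-t)) / 2) t := by
  exact ((h₁.hasDerivAt.add (hasDerivAt_comp_neg_of_differentiableAt h₂)).div_const 2).congr_deriv
    (by ring)

/-! ### The algebra of §1.3: from the single profile equation to the `(U, S)` system -/

/-- The half-difference and half-sum of the single profile equation (1.10) of the source
(`α = 1/3`) taken at `ζ` and at `−ζ` are the two profile equations of the vendored fact for
`U = (a − b)/2`, `S = (a + b)/2`, where `a = 𝒲(ζ)`, `b = 𝒲(−ζ)`, `a' = 𝒲′(ζ)`, `b' = 𝒲′(−ζ)`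
(so that `U′ = (a' + b')/2`, `S′ = (a' − b')/2`). [cite: BuckmasterCaolaboraGomezserrano2025,
§1.3 eq. (1.9)–(1.10)] -/
theorem US_system_of_profile_eq {r ζ a b a' b' : ℝ}
    (h₁ : (r - 1) * a + (ζ + 1 / 2 * (a - b + 1 / 3 * (a + b))) * a'
      + 1 / 3 / (2 * ζ) * (a ^ 2 - b ^ 2) = 0)
    (h₂ : (r - 1) * b + (-ζ + 1 / 2 * (b - a + 1 / 3 * (b + a))) * b'
      + 1 / 3 / (2 * -ζ) * (b ^ 2 - a ^ 2) = 0) :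
    ((r - 1) * ((a - b) / 2) + (ζ + (a - b) / 2) * ((a' + b') / 2)
        + 1 / 3 * ((a + b) / 2) * ((a' - b') / 2) = 0) ∧
    ((r - 1) * ((a + b) / 2) + (ζ + (a - b) / 2) * ((a' - b') / 2)
        + 1 / 3 * ((a + b) / 2) * ((a' + b') / 2 + 2 * ((a - b) / 2) / ζ) = 0) := by
  constructor
  · linear_combination (1 / 2 : ℝ) * h₁ - (1 / 2 : ℝ) * h₂
  · linear_combination (1 / 2 : ℝ) * h₁ + (1 / 2 : ℝ) * h₂

/-! ### Theorem 1.1 (`γ = 5/3`): from the paper's formulation to the vendored one -/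

/-- **Glue for Theorem 1.1 of Buckmaster–Cao-Labora–Gómez-Serrano at `γ = 5/3` (`α = 1/3`).**
The vendored named fact `BuckmasterCaolaboraGomezserrano2025_thm11_monatomic` follows from the
existence of a self-similar exponent `r` in the window and of a profile `𝒲 : ℝ → ℝ` of the Riemann
invariant `w` (extended to `ℝ` by `𝒵(ζ) = −𝒲(−ζ)`, §1.3) which is analytic at `ζ = 0`
(Prop. 2.5), smooth at every `ζ ≠ 0` (Thm 1.1: smooth through `P_s`), solves the single profile
equation (1.10) for `ζ ≠ 0`, satisfies `𝒲(ζ) + 𝒲(−ζ) > 0` for `ζ ≥ 0` (positive rescaled sound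
speed `S = (𝒲 − 𝒵)/2`, i.e. the orbit lies in `W > Z`, §1.3 / proof of Prop. 3.1), and ends at
`P_∞ = (0, 0)`, i.e. `W = 𝒲(ζ)/ζ → 0` and `Z = −𝒲(−ζ)/ζ → 0` as `ζ → +∞` (Prop. 3.1). The
profiles of the fact are `U = (𝒲 + 𝒵)/2` (odd part of `𝒲`) and `S = (𝒲 − 𝒵)/2` (even part).
[cite: BuckmasterCaolaboraGomezserrano2025, Thm 1.1, §1.3 eq. (1.10), Prop. 2.5, Prop. 3.1] -/
theorem thm11_monatomic_of_profile {r : ℝ} (hr₁ : (1.10102 : ℝ) < r) (hr₂ : r < (1.13476 : ℝ))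
    {𝒲 : ℝ → ℝ} (h_an : AnalyticAt ℝ 𝒲 0) (h_sm : ∀ ζ ≠ 0, ContDiffAt ℝ ∞ 𝒲 ζ)
    (h_ode : ∀ ζ ≠ 0, (r - 1) * 𝒲 ζ
      + (ζ + 1 / 2 * (𝒲 ζ - 𝒲 (-ζ) + 1 / 3 * (𝒲 ζ + 𝒲 (-ζ)))) * deriv 𝒲 ζ
      + 1 / 3 / (2 * ζ) * (𝒲 ζ ^ 2 - 𝒲 (-ζ) ^ 2) = 0)
    (h_pos : ∀ ζ, 0 ≤ ζ → 0 < 𝒲 ζ + 𝒲 (-ζ))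
    (h_limW : Tendsto (fun ζ => 𝒲 ζ / ζ) atTop (𝓝 0))
    (h_limZ : Tendsto (fun ζ => 𝒲 (-ζ) / ζ) atTop (𝓝 0)) :
    BuckmasterCaolaboraGomezserrano2025_thm11_monatomic := by
  -- even / odd germs at `0`
  obtain ⟨g, h, hg, hh, hgh⟩ := exists_sq_repr_of_analyticAt h_an
  have hgh' : ∀ᶠ t in 𝓝 (0 : ℝ), 𝒲 (-t) = g (t ^ 2) - t * h (t ^ 2) := by
    have := (continuous_neg.tendsto' (0 : ℝ) 0 neg_zero).eventually hgh
    filter_upwards [this] with t ht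
    rw [ht, neg_sq]
    ring
  -- the profiles: `U` = odd part (radial velocity), `S` = even part (rescaled sound speed)
  set U : ℝ → ℝ := fun t => (𝒲 t - 𝒲 (-t)) / 2 with hU
  set S : ℝ → ℝ := fun t => (𝒲 t + 𝒲 (-t)) / 2 with hS
  have hUS_sm : ∀ t ≠ 0, ContDiffAt ℝ ∞ U t ∧ ContDiffAt ℝ ∞ S t := by
    intro t ht
    have h1 := h_sm t ht
    have h2 : ContDiffAt ℝ ∞ (fun s => 𝒲 (-s)) t :=
      (h_sm (-t) (neg_ne_zero.mpr ht)).comp t contDiff_neg.contDiffAt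
    exact ⟨(h1.sub h2).div_const 2, (h1.add h2).div_const 2⟩
  have hU_repr : ∀ᶠ t in 𝓝 0, U t = t * h (t ^ 2) := by
    filter_upwards [hgh, hgh'] with t h1 h2
    simp only [hU, h1, h2]
    ring
  have hS_repr : ∀ᶠ t in 𝓝 0, S t = g (t ^ 2) := by
    filter_upwards [hgh, hgh'] with t h1 h2
    simp only [hS, h1, h2]
    ring
  have hd : ∀ t ≠ 0, DifferentiableAt ℝ 𝒲 t := fun t ht => (h_sm t ht).differentiableAt (by simp)
  refine ⟨r, hr₁, hr₂, U, S, ?_, ?_, ?_, ?_, ?_, ?_⟩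
  · -- smoothness of the radial velocity field `y ↦ U(|y|) y/|y|`
    exact contDiff_radialField_of_sq_repr (fun t ht => (hUS_sm t ht).1) hh hU_repr
  · -- smoothness of `y ↦ S(|y|)`
    exact contDiff_comp_norm_of_sq_repr (fun t ht => (hUS_sm t ht).2) hg hS_repr
  · -- the profile equations for `ζ > 0`
    intro ζ hζ
    have hζ' : ζ ≠ 0 := hζ.ne'
    have hdU : deriv U ζ = (deriv 𝒲 ζ + deriv 𝒲 (-ζ)) / 2 :=
      (hasDerivAt_oddPart (hd ζ hζ') (hd (-ζ) (neg_ne_zero.mpr hζ'))).deriv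
    have hdS : deriv S ζ = (deriv 𝒲 ζ - deriv 𝒲 (-ζ)) / 2 :=
      (hasDerivAt_evenPart (hd ζ hζ') (hd (-ζ) (neg_ne_zero.mpr hζ'))).deriv
    have h₁ := h_ode ζ hζ'
    have h₂ := h_ode (-ζ) (neg_ne_zero.mpr hζ')
    simp only [neg_neg] at h₂
    rw [hdU, hdS]
    exact US_system_of_profile_eq h₁ h₂
  · -- positivity of `S` on `[0, ∞)`
    intro ζ hζ
    show 0 < (𝒲 ζ + 𝒲 (-ζ)) / 2
    linarith [h_pos ζ hζ]
  · -- `U/ζ → 0`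
    have hlim := (h_limW.sub h_limZ).div_const 2
    rw [sub_zero, zero_div] at hlim
    refine hlim.congr' (Eventually.of_forall fun ζ => ?_)
    show (𝒲 ζ / ζ - 𝒲 (-ζ) / ζ) / 2 = (𝒲 ζ - 𝒲 (-ζ)) / 2 / ζ
    ring
  · -- `S/ζ → 0`
    have hlim := (h_limW.add h_limZ).div_const 2
    rw [add_zero, zero_div] at hlim
    refine hlim.congr' (Eventually.of_forall fun ζ => ?_)
    show (𝒲 ζ / ζ + 𝒲 (-ζ) / ζ) / 2 = (𝒲 ζ + 𝒲 (-ζ)) / 2 / ζ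
    ring

end BuckmasterCaolaboraGomezserrano2025

end Literature.Analysis.FluidPDE
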